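import Mathlib
import HarnessLib
import Summits.NavierStokesRegularity.NavierStokesRegularity.Theses.QuarterLogPincer
import Summits.NavierStokesRegularity.NavierStokesRegularity.Theorems.QuarterLogPincerThinCascadeDefs
import Summits.NavierStokesRegularity.NavierStokesRegularity.Theorems.QuarterLogPincerTruncationEdgeDefs
import Summits.NavierStokesRegularity.NavierStokesRegularity.Theorems.QuarterLogPincerTruncationEdgeCore
import Summits.NavierStokesRegularity.NavierStokesRegularity.Theorems.QuarterLogPincerTruncationEdgeAnatomyDefs
import Summits.NavierStokesRegularity.NavierStokesRegularity.Theorems.QuarterLogPincerQuietCollarDefs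
import Summits.NavierStokesRegularity.NavierStokesRegularity.Theorems.QuarterLogPincerQuietCollarAnatomyLog
import Summits.NavierStokesRegularity.NavierStokesRegularity.Theorems.QuarterLogPincerQuietCoreDeflicker
import Literature.Analysis.FluidPDE.TypeIAncientMild
import Literature.Analysis.FluidPDE.DyadicChaining

/-!
# Route `QuarterLogPincer`, crux `TypeIQuantSubcubicExp` (stmt-NavierStokesRegularity-24077), line `quiet_collar` —
# THE EDGE BY NAME, UNCONDITIONAL: 24077 ⇒ `LogCubeFloorLiouville`

ns-idea-7's LOOP line `quiet_collar` (tree `Cruxes/TypeIQuantSubcubicExp/Lines/quiet_collar.lean`) types the residual of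
W7 over the DSS wall as Q1 (edge) and Q2 (converse) and, modulo them, identifies the crux with `LogCubeFloorLiouville`
(`…QuietCollarDefs`).  Q1 `StubQuietTruncation` is now a tree theorem by name (`stub_quietTruncation_log`,
`…QuietCollarAnatomyLog`, from QP1-log, QP2-log, QP3, P2), so the line's EDGE holds with NO line hypothesis:

* `truncatedFamily_of_localFloor`, `not_typeIQuantSubcubicExp_of_logCube_floor`,
  `typeIQuantSubcubicExp_of_logCubeFloorLiouville` — the author's kernel-checked arithmetic family / refutation /
  converse (quiet_collar.lean, bodies BYTE-IDENTICAL; ported so that the edge is importable).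
* ★ `logCubeFloorLiouville_of_typeIQuantSubcubicExp_log : TypeIQuantSubcubicExp → LogCubeFloorLiouville` — THE EDGE,
  unconditional (24077 ⇒ every Type-I ancient mild field with the log-cube budget and a LOCALISED rate floor is excluded).
* `typeIQuantSubcubicExp_iff_logCubeFloorLiouville_log : StubLogCubeExtraction → (24077 ↔ LogCubeFloorLiouville)` — the
  loop now rests on the single converse-side input Q2.
* ★ `logCubeLiouville_of_typeIQuantSubcubicExp_deflickered : TypeIQuantSubcubicExp → LogCubeLiouville` — the VALUE of
  the crux in the apex form (24077 ⇒ no Type-I ancient mild field with the log-cube budget is singular at the apex),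
  unconditional: the edge composed with the quiet-core de-flickering `QuietCore.logCubeLiouville_of_edge`
  (`…QuietCoreDeflicker`, from the landed `quietCore_all`); `logCubeLiouville_of_typeIQuantSubcubicExp_log` is the
  author's Q3-form (modulo `StubLocalRateFloor`), kept for the record.

HONEST FRAME: an implication OUT OF the crux, about HYPOTHETICAL Type-I ancient mild fields; it attacks no wall; Q2, Q3,
24077, 22144, W7 and Navier–Stokes regularity are OPEN / not proved.  pub-ns-dss typer (g37),
`--supports stmt-NavierStokesRegularity-24077`; verbatim bodies by ns-idea-7.
-/

noncomputable section

set_option linter.dupNamespace false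

namespace Summit.NavierStokesRegularity.NavierStokesRegularity.Cruxes.TypeIQuantSubcubicExp.QuietCollar

open MeasureTheory Set Function Metric Filter Topology
open scoped ENNReal NNReal
open Literature.Analysis Literature.Analysis.FluidPDE
open Summit.NavierStokesRegularity.NavierStokesRegularity.Cruxes.TypeIQuantSubcubicExp.ThinCascade
  (TaoFrame ThinObject SingularAt)
open Summit.NavierStokesRegularity.NavierStokesRegularity.Cruxes.TypeIQuantSubcubicExp.TruncationEdge
  (QuantSubcubicExpAt TruncatedFamily FarFieldTruncation EnvelopeCubeBudget
   not_typeIQuantSubcubicExp_of_truncatedFamily)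

/-! ### The arithmetic family from a localised floor, the refutation, the converse (author's, verbatim) -/

/-- **From the parts to a truncated family, with a LOCALISED floor** (replacing the envelope of
`TruncationEdge.truncatedFamily_of_parts`): T1's conclusion at accuracy `δ = min 1 (c/2)`, the log-cube budget
with `log R ≤ log K + κ log(1/ε)`, the floor point in `B(1)` for `ε ≤ −s₀`. [this file; line theorem] -/
theorem truncatedFamily_of_localFloor {M : ℝ}
    {v : ℝ → EuclideanSpace ℝ (Fin 3) → EuclideanSpace ℝ (Fin 3)}
    (hT : FarFieldTruncation M v) (hBud : EnvelopeCubeBudget v) (hF : LocalRateFloor v) :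
    ∃ K₁ K₂ c ε₀ : ℝ, 0 < K₂ ∧ 0 < c ∧ 0 < ε₀ ∧ ε₀ ≤ 1 / 2 ∧
      TruncatedFamily (M + 1) K₁ K₂ c ε₀ := by
  obtain ⟨c, s₀, hc, hs₀, hfloor⟩ := hF
  obtain ⟨κ, K, hκ, hK, hfam⟩ := hT (min 1 (c / 2)) (by positivity) (min_le_left _ _)
  obtain ⟨B', hB0, hbud⟩ := hBud
  have hKpos : 0 < K := by linarith
  refine ⟨32 + 16 * (B' + K) * (1 + Real.log K), 16 * (B' + K) * (κ + 1) + 1, c / 2,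
    min (1 / 2) (-s₀), by positivity, by positivity, lt_min (by norm_num) (by linarith),
    min_le_left _ _, ?_⟩
  intro ε hε
  have hεpos : 0 < ε := hε.1
  have hεhalf : ε ≤ 1 / 2 := hε.2.trans (min_le_left _ _)
  have hεs₀ : ε ≤ -s₀ := hε.2.trans (min_le_right _ _)
  have hεone : ε ≤ 1 := by linarith
  obtain ⟨R, u, p, hR2, hRK, hframe, hrate, ⟨k, hk0, hk3, hL3⟩, hclose⟩ := hfam ε ⟨hεpos, hεhalf⟩
  obtain ⟨b, hb0, hb3, hbv⟩ := hbud R hR2 ε ⟨hεpos, hεone⟩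
  have hL3u := hL3 b hb0 hbv
  have hlog1 : 0 ≤ Real.log (1 / ε) := by
    apply Real.log_nonneg
    rw [le_div_iff₀ hεpos]; linarith
  have hlogR : Real.log R ≤ Real.log K + κ * Real.log (1 / ε) := by
    have hRpos : 0 < R := by linarith
    have h1 : Real.log R ≤ Real.log (K * ε ^ (-κ)) := Real.log_le_log hRpos hRK
    have h2 : Real.log (K * ε ^ (-κ)) = Real.log K + κ * Real.log (1 / ε) := by
      rw [Real.log_mul hKpos.ne' (Real.rpow_pos_of_pos hεpos _).ne', Real.log_rpow hεpos,
        one_div, Real.log_inv]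
      ring
    linarith
  refine ⟨2 + b + k, u, p, hframe, hrate, fun t ht => (hL3u t ht).trans
    (ENNReal.ofReal_le_ofReal (by linarith)), by linarith, ?_, ?_⟩
  · have h1 : (2 + b + k) ^ 3 ≤ 4 * 2 ^ 3 + 4 * (b + k) ^ 3 := by
      have := DyadicChaining.add_pow_three_le_four (x := 2) (y := b + k) (by norm_num) (by linarith)
      calc (2 + b + k) ^ 3 = (2 + (b + k)) ^ 3 := by ring
        _ ≤ 4 * 2 ^ 3 + 4 * (b + k) ^ 3 := this
    have h1' : (b + k) ^ 3 ≤ 4 * b ^ 3 + 4 * k ^ 3 := DyadicChaining.add_pow_three_le_four hb0 hk0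
    have hLle : 1 + Real.log R + Real.log (1 / ε) ≤
        1 + Real.log K + (κ + 1) * Real.log (1 / ε) := by linarith
    have hBK : 0 ≤ B' + K := by linarith
    have h2 : b ^ 3 + k ^ 3 ≤ (B' + K) * (1 + Real.log R + Real.log (1 / ε)) := by nlinarith
    have h3 : (B' + K) * (1 + Real.log R + Real.log (1 / ε)) ≤
        (B' + K) * (1 + Real.log K + (κ + 1) * Real.log (1 / ε)) :=
      mul_le_mul_of_nonneg_left hLle hBK
    have h4 : 16 * (B' + K) * (κ + 1) * Real.log (1 / ε) ≤
        (16 * (B' + K) * (κ + 1) + 1) * Real.log (1 / ε) :=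
      mul_le_mul_of_nonneg_right (by linarith) hlog1
    nlinarith [h1, h1', h2, h3, h4]
  · -- the floor, already localised in the unit ball for `−ε ∈ [s₀, 0)`
    obtain ⟨x, hxball, hx⟩ := hfloor (-ε) ⟨by linarith, by linarith⟩
    rw [neg_neg] at hx
    have hsq : 0 < Real.sqrt ε := Real.sqrt_pos.2 hεpos
    have hcl := hclose x hxball
    have hδ : min 1 (c / 2) ≤ c / 2 := min_le_right _ _
    have htri : ‖v (-ε) x‖ - ‖u (1 - ε) x‖ ≤ ‖u (1 - ε) x - v (-ε) x‖ := by
      rw [norm_sub_rev]; exact norm_sub_norm_le _ _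
    refine ⟨x, ?_⟩
    have hhalf : c / 2 ≤ c / 2 / Real.sqrt ε := by
      have hsq1 : Real.sqrt ε ≤ 1 := by
        rw [← Real.sqrt_one]; exact Real.sqrt_le_sqrt hεone
      rw [le_div_iff₀ hsq]; nlinarith
    have : c / Real.sqrt ε = c / 2 / Real.sqrt ε + c / 2 / Real.sqrt ε := by ring
    linarith

/-- **A log-cube field with a localised floor refutes the crux, given Q1** (with the landed arithmetic core
`not_typeIQuantSubcubicExp_of_truncatedFamily`). [this file; line theorem] -/
theorem not_typeIQuantSubcubicExp_of_logCube_floor (hQ1 : StubQuietTruncation) {M : ℝ}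
    {v : ℝ → EuclideanSpace ℝ (Fin 3) → EuclideanSpace ℝ (Fin 3)}
    (hv : IsTypeIAncientMild M v) (hbud : EnvelopeCubeBudget v) (hfloor : LocalRateFloor v) :
    ¬ Summit.NavierStokesRegularity.NavierStokesRegularity.Theses.QuarterLogPincer.TypeIQuantSubcubicExp := by
  obtain ⟨M', hT⟩ := hQ1 M v hv hbud
  obtain ⟨K₁, K₂, c, ε₀, hK₂, hc, hε₀, hε₀', hTF⟩ := truncatedFamily_of_localFloor hT hbud hfloor
  exact not_typeIQuantSubcubicExp_of_truncatedFamily hK₂ hc hε₀ hε₀' hTF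

/-- **THE CONVERSE — LOG-CUBE FLOOR LIOUVILLE ⇒ 24077, modulo Q2.** [this file; line theorem] -/
theorem typeIQuantSubcubicExp_of_logCubeFloorLiouville (hQ2 : StubLogCubeExtraction)
    (hL : LogCubeFloorLiouville) :
    Summit.NavierStokesRegularity.NavierStokesRegularity.Theses.QuarterLogPincer.TypeIQuantSubcubicExp := by
  by_contra h
  obtain ⟨M, v, hv, hbud, hfloor⟩ := hQ2 h
  exact hL M v hv hbud hfloor

/-! ### The edge, unconditional -/

/-- ★ **THE EDGE, UNCONDITIONAL — 24077 ⇒ LOG-CUBE FLOOR LIOUVILLE.**  The line theorem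
`logCubeFloorLiouville_of_typeIQuantSubcubicExp : Q1 → 24077 → LogCubeFloorLiouville` with its Q1 hypothesis discharged
by `stub_quietTruncation_log`. [line quiet_collar, ns-idea-7; Q1 by name pub-ns-dss typer] -/
theorem logCubeFloorLiouville_of_typeIQuantSubcubicExp_log
    (h : Summit.NavierStokesRegularity.NavierStokesRegularity.Theses.QuarterLogPincer.TypeIQuantSubcubicExp) :
    LogCubeFloorLiouville :=
  fun _ _ hv hbud hfloor => not_typeIQuantSubcubicExp_of_logCube_floor stub_quietTruncation_log hv hbud hfloor h

/-- **THE LOOP modulo Q2 alone**: given the converse-side input `StubLogCubeExtraction`, the crux 24077 IS the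
log-cube floor Liouville statement. [line quiet_collar; Q1 by name] -/
theorem typeIQuantSubcubicExp_iff_logCubeFloorLiouville_log (hQ2 : StubLogCubeExtraction) :
    Summit.NavierStokesRegularity.NavierStokesRegularity.Theses.QuarterLogPincer.TypeIQuantSubcubicExp ↔
      LogCubeFloorLiouville :=
  ⟨logCubeFloorLiouville_of_typeIQuantSubcubicExp_log, typeIQuantSubcubicExp_of_logCubeFloorLiouville hQ2⟩

/-- Value upgrade modulo Q3 only: `StubLocalRateFloor → 24077 → LogCubeLiouville` (the `SingularAt` form).
[line quiet_collar; Q1 by name] -/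
theorem logCubeLiouville_of_typeIQuantSubcubicExp_log (hQ3 : StubLocalRateFloor)
    (h : Summit.NavierStokesRegularity.NavierStokesRegularity.Theses.QuarterLogPincer.TypeIQuantSubcubicExp) :
    LogCubeLiouville :=
  fun M v hv hbud hsing =>
    logCubeFloorLiouville_of_typeIQuantSubcubicExp_log h M v hv hbud (hQ3 M v hv hsing)

/-- ★ **THE VALUE OF THE CRUX, DE-FLICKERED AND UNCONDITIONAL — 24077 ⇒ `LogCubeLiouville`**: if the quarter-log
pincer crux holds, no Type-I ancient mild field with the log-shaped cube budget is singular at the apex.  The edge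
`logCubeFloorLiouville_of_typeIQuantSubcubicExp_log` composed with ns-idea-7's quiet-core de-flickering
`QuietCore.logCubeLiouville_of_edge` (Q3♭ from the landed `quietCore_all`). [lines quiet_collar + quiet_core, ns-idea-7;
composition by name pub-ns-dss typer] -/
theorem logCubeLiouville_of_typeIQuantSubcubicExp_deflickered
    (h : Summit.NavierStokesRegularity.NavierStokesRegularity.Theses.QuarterLogPincer.TypeIQuantSubcubicExp) :
    LogCubeLiouville :=
  QuietCore.logCubeLiouville_of_edge logCubeFloorLiouville_of_typeIQuantSubcubicExp_log h

end Summit.NavierStokesRegularity.NavierStokesRegularity.Cruxes.TypeIQuantSubcubicExp.QuietCollar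

end
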